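import Literature.AlgebraicGeometry.Frobenioids.PadicFrobenioidConstantMonoid
import Literature.AlgebraicGeometry.Frobenioids.PadicFrobenioidRationalData
import Literature.AlgebraicGeometry.Frobenioids.PadicFrobenioidPreModel
import Literature.AlgebraicGeometry.Frobenioids.FrobenioidRealification
import Literature.AnabelianGeometry.EtaleTheta.MonoprimeStructure
import Literature.AlgebraicGeometry.Frobenioids.QuasiTemperoidGaloisPadicFields
import Literature.AlgebraicGeometry.Frobenioids.QuasiTemperoidGaloisFieldsEquivalence
import Literature.AnabelianGeometry.SemiGraphs.CosetCategoriesBridge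
import Literature.AnabelianGeometry.SemiGraphs.CosetCategoriesFSM
import Literature.AnabelianGeometry.AbsoluteAnabelian.SubpadicSlimProofs
import Literature.AnabelianGeometry.AbsoluteAnabelian.SubpadicExamples
import HarnessLib

/-!
# Frobenioids II, Example 1.1 (i): the `p`-adic Frobenioid `C₀` over THE base `D₀ = 𝓑(G_{ℚ_p})⁰` — every
# hypothesis discharged

Mochizuki, *The geometry of Frobenioids II*, Kyushu J. Math. **62** (2008) 401–460, §1, author's text p. 7
[cite: MochizukiFrdII2008, Ex 1.1 (i) p.7]: "write `D₀` for the full subcategory of connected objects of the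
Galois category of finite étale coverings of `Spec(ℚ_p)`. Thus, `D₀` is a connected, totally epimorphic category,
which is of FSM-, hence also of FSMFF-type. … by [FrdI], Theorem 5.2, (ii), this data [`Φ₀`, `B₀ → Φ₀^gp`]
determines a [model] Frobenioid `C₀` which is easily verified to be of rationally standard type [cf. [FrdI],
Theorem 5.2, (iii)] over a slim base category `D₀` [cf. [AbsAnab], Theorem 1.1.1, (ii); …]."

The tree types Example 1.1 over an ARBITRARY base functor `D → (p-adic valued fields)` (`PadicFrd.Datum`,
`PadicFrd.Datum.zero` = the datum of `C₀|_D`; abc-iut-L1-t4). This file instantiates it at the printed base: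

* `PadicFrd.DZero p` — `D₀` as the SMALL coset category `CosetCat G_{ℚ_p}` (abc-iut-L5-t2's
  `CosetCategories.lean`; objects the open subgroups `U ⊆ G_{ℚ_p} = Gal(ℚ̄_p/ℚ_p)` standing for the transitive
  `G_{ℚ_p}`-sets `G_{ℚ_p}/U`, i.e. the connected finite étale coverings `Spec ℚ̄_p^U → Spec ℚ_p`), EQUIVALENT to
  the connected part `ConnectedPart (BTemp G_{ℚ_p})` of the temperoid (`nonempty_dZero_equivalence`,
  abc-iut-L5-t2's `CosetCat.equivConnectedPart`) — the small model is forced by universes: `PadicFrd.Datum`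
  wants the base and the fields in one universe, while `ConnectedPart (BTemp G_{ℚ_p})` lives one universe up;
* `PadicFrd.baseZero p : DZero p ⥤ PadicFld p` — `U ↦ Spec ℚ̄_p^U` with the `p`-adic (spectral-norm) valuation
  (abc-iut-w4-d018's `QuasiTemperoid.galoisPadicFields` along the equivalence), every value a `p`-adic local
  field (`baseZero_isPadicLocal`);
* `PadicFrd.Datum.zeroGal p` / `PadicFrd.CZeroGal p` — THE printed `C₀`: `Datum.zero` over `baseZero p`, its
  hypotheses (connected, totally epimorphic, `ord(O_K^⊳)` monoprime) DISCHARGED;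
* the printed claims, kernel-closed BY NAME of the general theorems: `D₀` of FSM- and FSMFF-type
  (`dZero_isOfFSMType`, `CosetCategoriesFSM.lean`); "`Φ₀`, `B₀` monoids on `D₀`" (`zeroGal_isMonoidData`);
  "determines a [model] Frobenioid `C₀`" (`czeroGal_isFrobenioid`, [FrdI] Thm. 5.2 (ii) via abc-iut-L1-d8/d10;
  `czeroGal_modelType`); the standard-type half of "rationally standard type" (`czeroGal_isOfStandardType`,
  [FrdI] Thm. 5.2 (iii) via abc-iut-L1-d10 — the rationality half is the [FrdI] Def. 4.5 (iii) residue of node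
  FrdII:Thm1.2(i), `PadicFrd.Datum.isOfRationallyStandardType_data_iff`, not repeated); "a slim base category
  `D₀` [cf. [AbsAnab] Thm. 1.1.1 (ii)]" at the group level: `G_{ℚ_p}` is slim (`galQp_isSlimGroup`, abc-iut-L4-d2's
  PROVED `IsSubpadicFor.isSlimGroup_absoluteGaloisGroup`); and the p. 8 claim "`Φ₀^Λ` is isomorphic to the constant
  monoid `ℝ_{≥0}` on `D₀`" (`phiZeroGalIsoConst`, from `PadicFrobenioidConstantMonoid.lean`).

Nothing of [FrdI]/[FrdII] is re-typed; no statement is strengthened; nothing here bears on [IUTchIII].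
-/

namespace Literature.AlgebraicGeometry.Frobenioids

namespace PadicFrd

open CategoryTheory Literature.AnabelianGeometry.SemiGraphs Literature.AnabelianGeometry.AbsoluteAnabelian
open QuasiTemperoid

variable (p : ℕ) [Fact p.Prime]

/-! ### `D₀` and the base functor `Spec K ↦ (K, v_p)` -/

/-- **`D₀`** (FrdII p. 7): "the full subcategory of connected objects of the Galois category of finite étale
coverings of `Spec(ℚ_p)`", as the small coset category of `G_{ℚ_p} = Gal(ℚ̄_p/ℚ_p)` (Krull topology): the object
`U` stands for the connected covering with fibre `G_{ℚ_p}/U`, i.e. `Spec ℚ̄_p^U`. [cite: MochizukiFrdII2008, Ex 1.1 (i) p.7] -/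
abbrev DZero : Type := CosetCat (GalFbar ℚ_[p])

/-- `D₀` is equivalent to the connected part `𝓑^temp(G_{ℚ_p})⁰` of the temperoid of `G_{ℚ_p}` (the tree's other
model of "connected objects of the Galois category", abc-iut-L1-t4/w4-d018), by abc-iut-L5-t2's
`CosetCat.equivConnectedPart` (`G_{ℚ_p}` is tempered, `isTempered_galFbar`). [cite: MochizukiFrdII2008, Ex 1.1 (i) p.7] -/
theorem nonempty_dZero_equivalence : Nonempty (DZero p ≌ ConnectedPart (BTemp (GalFbar ℚ_[p]))) :=
  ⟨CosetCat.equivConnectedPart (isTempered_galFbar ℚ_[p])⟩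

/-- **The base functor `D₀ → (p-adic valued fields)`**: `U ↦ Spec ℚ̄_p^U` with the restriction of the `p`-adic
valuation of `ℚ̄_p` (abc-iut-w4-d018's `galoisPadicFields`, precomposed with the equivalence
`CosetCat G_{ℚ_p} ⥤ 𝓑^temp(G_{ℚ_p})⁰`). [cite: MochizukiFrdII2008, Ex 1.1 (i) p.7] -/
noncomputable def baseZero : DZero p ⥤ PadicFld.{0} p :=
  CosetCat.toConnected (isTempered_galFbar ℚ_[p]) ⋙ galoisPadicFields p

/-- "[i.e., `K` is a finite extension of `ℚ_p`]" (FrdII p. 7): every value of the base functor is a `p`-adic local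
field with its `p`-adic valuation. [cite: MochizukiFrdII2008, Ex 1.1 (i) p.7] -/
theorem baseZero_isPadicLocal (A : DZero p) : ((baseZero p).obj A).IsPadicLocal :=
  isPadicLocal_galoisPadicFields p _

/-- "`D₀` is … of FSM-type" (FrdII p. 7) — every monomorphism of `D₀` is an isomorphism
(`CosetCat.isOfFSMType`). [cite: MochizukiFrdII2008, Ex 1.1 (i) p.7] -/
theorem dZero_isOfFSMType : IsOfFSMType (DZero p) := CosetCat.isOfFSMType

/-- "hence also of FSMFF-type" (FrdII p. 7). [cite: MochizukiFrdII2008, Ex 1.1 (i) p.7] -/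
theorem dZero_isOfFSMFFType : IsOfFSMFFType (DZero p) := CosetCat.isOfFSMFFType

/-- "`D₀` is a connected … category" (FrdII p. 7). [cite: MochizukiFrdII2008, Ex 1.1 (i) p.7] -/
theorem dZero_isConnected : IsConnected (DZero p) := CosetCat.isConnected

/-- "`D₀` is a … totally epimorphic category" (FrdII p. 7). [cite: MochizukiFrdII2008, Ex 1.1 (i) p.7] -/
theorem dZero_isTotallyEpimorphic : IsTotallyEpimorphic (DZero p) := CosetCat.isTotallyEpimorphic

/-- "over a slim base category `D₀` [cf. [AbsAnab], Theorem 1.1.1, (ii)]" (FrdII p. 7), at the level of the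
group: `G_{ℚ_p}` is slim — every open subgroup has trivial centraliser (abc-iut-L4-d2's PROVED [pGC] Lem. 15.8
for sub-`p`-adic fields, `IsSubpadicFor.isSlimGroup_absoluteGaloisGroup`, at `ℚ_p` itself). The passage to the
slimness of the CATEGORY `D₀` ([FrdI] §0) is [SemiAnbd] Rmk. 3.4.1 for the temperoid (`slimIffTempSlim_holds`)
and is not repeated for the small model here. [cite: MochizukiFrdII2008, Ex 1.1 (i) p.7] -/
theorem galQp_isSlimGroup : IsSlimGroup (GalFbar ℚ_[p]) :=
  Literature.AnabelianGeometry.AbsoluteAnabelian.IsSubpadicFor.isSlimGroup_absoluteGaloisGroup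
    (AbsTopIII.IsSubpadicFor.padic p)

/-- "a monoid `Φ₀` on `D₀` … easily verified to be non-dilating and perf-factorial [cf. [FrdI], Definition
2.4, (i)]" (FrdII p. 7) — PERF-FACTORIAL, for the divisor monoid of ANY `p`-adic Frobenioid datum (each `Φ(A)` is
monoprime, and a monoprime monoid is perf-factorial: abc-iut-L2's `MonoprimeStructure.isPerfFactorial`); the
non-dilating half is abc-iut-L1-d10's `PadicFrd.Datum.isNonDilatingOn`. [cite: MochizukiFrdII2008, Ex 1.1 (i) p.7] -/
theorem Datum.isPerfFactorialOn {D : Type} [Category D] (d : Datum D p) :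
    PreFrobenioid.IsPerfFactorialOn d.Φ :=
  fun _ => Literature.AnabelianGeometry.EtaleTheta.MonoprimeStructure.isPerfFactorial (d.isMonoprime _)

/-! ### `C₀` over `D₀`, hypotheses discharged -/

/-- **Example 1.1 (i)**, THE printed `C₀`: the datum (`Φ₀`, `B₀`, `B₀ → Φ₀^gp`) of the `p`-adic Frobenioid `C₀`
over `D₀` itself — `PadicFrd.Datum.zero` at the base functor `baseZero p`, with its three hypotheses
discharged: `D₀` connected (`CosetCat.isConnected`), totally epimorphic (`CosetCat.isTotallyEpimorphic`), and
`ord(O_K^⊳)` monoprime for every `Spec K ∈ Ob(D₀)` (`IsPadicLocal.isMonoprime_ordInt`).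
[cite: MochizukiFrdII2008, Ex 1.1 (i) p.7] -/
noncomputable def Datum.zeroGal : Datum (DZero p) p :=
  Datum.zero (baseZero p) (baseZero_isPadicLocal p) CosetCat.isConnected CosetCat.isTotallyEpimorphic
    fun A => (baseZero_isPadicLocal p A).isMonoprime_ordInt

/-- **`C₀`** (FrdII p. 7): "this data determines a [model] Frobenioid `C₀`" — the category, over THE base `D₀`.
[cite: MochizukiFrdII2008, Ex 1.1 (i) p.7] -/
abbrev CZeroGal : Type := (Datum.zeroGal p).frobenioid

/-- The base functor of `C₀`'s datum is `baseZero p`. [cite: MochizukiFrdII2008, Ex 1.1 (i) p.7] -/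
theorem zeroGal_base : (Datum.zeroGal p).base = baseZero p := rfl

/-- The divisor monoid of `C₀` is `Φ₀|_{D₀}` itself (no subfunctor chosen). [cite: MochizukiFrdII2008, Ex 1.1 (i) p.7] -/
theorem zeroGal_Φ : (Datum.zeroGal p).Φ = phiZeroOn (baseZero p) := rfl

/-- "determines a monoid `Φ₀` on `D₀` … a group-like monoid `B₀` on `D₀`" (FrdII p. 7; [FrdI] Def. 1.1 (ii)):
`Φ₀`, `B₀` ARE monoids on `D₀` (abc-iut-L1-d10's `isMonoidData_of_isOfFSMType` at the FSM-type base `D₀`).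
[cite: MochizukiFrdII2008, Ex 1.1 (i) p.7] -/
theorem zeroGal_isMonoidData : (Datum.zeroGal p).IsMonoidData :=
  (Datum.zeroGal p).isMonoidData_of_isOfFSMType (dZero_isOfFSMType p)

/-- "`Φ₀` … non-dilating and perf-factorial" (FrdII p. 7) at THE base `D₀`. [cite: MochizukiFrdII2008, Ex 1.1 (i) p.7] -/
theorem zeroGal_isPerfFactorialOn_and_isNonDilatingOn :
    PreFrobenioid.IsPerfFactorialOn (Datum.zeroGal p).Φ ∧ IsNonDilatingOn (Datum.zeroGal p).Φ :=
  ⟨(Datum.zeroGal p).isPerfFactorialOn p, (Datum.zeroGal p).isNonDilatingOn⟩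

/-- **"this data determines a [model] Frobenioid `C₀`"** (FrdII p. 7; [FrdI] Thm. 5.2 (ii)): `C₀ → F_{Φ₀}` IS a
Frobenioid (abc-iut-L1-d8/d10's `isFrobenioid_of_isOfFSMType`). [cite: MochizukiFrdII2008, Ex 1.1 (i) p.7] -/
theorem czeroGal_isFrobenioid : PreFrobenioid.IsFrobenioid (Datum.zeroGal p).structureFunctor :=
  (Datum.zeroGal p).isFrobenioid_of_isOfFSMType (dZero_isOfFSMType p)

/-- "[model] Frobenioid" (FrdII p. 7; [FrdI] Def. 4.5 (i)): `C₀` is of pre-model type and birationally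
Frobenius-normalized at its birationalization (abc-iut-w4-d108 / abc-iut-L1-d10, `thm12_modelType_of_isOfFSMType'`).
[cite: MochizukiFrdII2008, Ex 1.1 (i) p.7] -/
theorem czeroGal_modelType :
    PreFrobenioid.IsOfPreModelType (Datum.zeroGal p).structureFunctor ∧
      PreFrobenioidData.IsOfBiratFrobeniusNormalizedType
        (PreFrobenioid.biratData (czeroGal_isFrobenioid p)
          ((Datum.zeroGal p).hasBiratSquares (czeroGal_isFrobenioid p))) :=
  (Datum.zeroGal p).thm12_modelType_of_isOfFSMType' (dZero_isOfFSMType p)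

/-- **"easily verified to be of rationally standard type [cf. [FrdI], Theorem 5.2, (iii)]"** (FrdII p. 7) — the
STANDARD-TYPE half ([FrdI] Def. 3.1 (i)), kernel-closed over `D₀` (abc-iut-L1-d10's
`thm12_isOfStandardType_of_isOfFSMType`; the rationality conjuncts of [FrdI] Def. 4.5 (iii) are the residue of
node FrdII:Thm1.2(i), `isOfRationallyStandardType_data_iff`). [cite: MochizukiFrdII2008, Ex 1.1 (i) p.7] -/
theorem czeroGal_isOfStandardType :
    (ModelFrobenioid.data (Datum.zeroGal p).Φ (Datum.zeroGal p).B (Datum.zeroGal p).divB).IsOfStandardType :=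
  (Datum.zeroGal p).thm12_isOfStandardType_of_isOfFSMType (dZero_isOfFSMType p)

/-- **Example 1.1 (i)** (FrdII p. 8): "the monoid `Φ₀^Λ` is isomorphic to the constant monoid determined by
`ℝ_{≥0} ∈ Ob(Mon)` on `D₀`" — at THE base `D₀`: `Φ_{C₀} = Φ₀|_{D₀} ≅ ℝ_{≥0}` (componentwise the normalised
order `ord_p`, `PadicFrd.phiZeroIsoConst`). [cite: MochizukiFrdII2008, Ex 1.1 (i) p.8] -/
noncomputable def phiZeroGalIsoConst : (Datum.zeroGal p).Φ ≅ constNNReal (DZero p) :=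
  phiZeroIsoConst (baseZero p) (baseZero_isPadicLocal p)

/-- The printed p. 8 claim at `D₀`, as a proposition. [cite: MochizukiFrdII2008, Ex 1.1 (i) p.8] -/
theorem nonempty_phiZeroGal_iso_const : Nonempty ((Datum.zeroGal p).Φ ≅ constNNReal (DZero p)) :=
  ⟨phiZeroGalIsoConst p⟩

end PadicFrd

end Literature.AlgebraicGeometry.Frobenioids
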